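import Literature.MathematicalPhysics.QuantumFieldTheory.Balaban1983to89.B8Ineq159FlatCovDentedCubeMemberRec

/-!
# CLOSED SKELETON — `Ineq159FlatCubeMemberCovPrintedZ (d+1) (ℓ+1)` ∧ `Ineq159FlatDentedCubeMemberCovPrintedZ (d+1) (ℓ+1)` (odd `ℓ+1 ≥ 5`)
# (seat pub-ymgap-dag-n05-cov g0; item stmt-QuantumFields-20541, --supports).  ALL SIX STUBS LANDED:

* S1 → `B7Prop4FlatCarriedLetterOscRec.norm_carried_flat_le_osc` (p733193, commit 945c011ec92d)
* S2 → `B8FlatCurlOscillationZd.exists_plaqCovDeriv_osc_const` (p732730, commit 8dbceb663880)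
* S3 → `B8Ineq159FlatCovCubeMemberRec.box_subset_cubeZ_pred` (p733782, commit 4834d69c3190)
* S4 → `B8Ineq159FlatCovCubeMemberRec.exists_weighted_max` ∕ `B8Ineq159FlatCovDentedCubeMemberRec.exists_weighted_max_of_subset`
* S5 → `B8Ineq159FlatCovCubeMemberRec.cov_of_straight` (p733782)
* S6 → `B8Ineq159FlatCovDentedCubeMemberRec.covDented_of_straight` (p734150)
-/

noncomputable section

namespace Literature.MathematicalPhysics.QuantumFieldTheory.Balaban1983to89.B8Ineq159FlatCovRec

open B8Ineq159FlatCovPrintedRec (Ineq159FlatCubeMemberCovPrintedZ Ineq159FlatDentedCubeMemberCovPrintedZ)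

/-- ★★★ both named facts of `B8Ineq159FlatCovPrintedRec`, every odd `L = ℓ+1 ≥ 5` (re-export of the landed theorem). -/
theorem ineq159FlatCovPrintedZ_holds (d ℓ : ℕ) (hℓ : 4 ≤ ℓ) (hodd : Odd (ℓ + 1)) :
    Ineq159FlatCubeMemberCovPrintedZ (d + 1) (ℓ + 1) ∧ Ineq159FlatDentedCubeMemberCovPrintedZ (d + 1) (ℓ + 1) :=
  B8Ineq159FlatCovDentedCubeMemberRec.ineq159FlatCovPrintedZ_holds d ℓ hℓ hodd

end Literature.MathematicalPhysics.QuantumFieldTheory.Balaban1983to89.B8Ineq159FlatCovRec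

end
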